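import Literature.MathematicalPhysics.QuantumFieldTheory.QCDFlavourSymmetry
import Summits.QuantumFields.QCD.Theorems.PauliWegnerSeaChiralGluonicCompletionStubLatticeGapTwoDegenerateOfNeutral
import HarnessLib

/-!
# Crux `TorusHalfSpectrum` (stmt-QuantumFields-9508), line `registered` (`Lines/birth.lean`) —
# stub `stub_selection_rule`: the exact flavour selection rule

Stub 3a of the birth skeleton of the crux
`Summit.QuantumFields.QCD.Theses.QuarksNoInfraredClause.TorusHalfSpectrum` (= `SelectionRuleStmt` unfolded):
a pair of FLAVOUR-HOMOGENEOUS gauge-invariant local lattice QCD observables `A`, `B` — the vector flavour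
torus `t ∈ (ℂˣ)^{N_f}` multiplies `A.F U` by the character `∏_f t_f^{q_A f}` and `B.F U` by `∏_f t_f^{q_B f}`
(`QCDLatticeObservable.flavourScale`) — whose integer charge vectors are NOT opposite, `q_A + q_B ≠ 0`,
clusters at EVERY rate `Δ` along EVERY scheme, in the quantifier shape of `QCDScheme.HasLatticeMassGap`,
because its connected Euclidean-time correlation `qcdLatticeConnectedCorr β S m A B n = ⟨A(0)·B(n e₀)⟩ − ⟨A⟩⟨B⟩`
VANISHES IDENTICALLY on every torus, at every `β` and for all bare masses:

* `⟨A(0)·B(n e₀)⟩ = 0`: the torus placement intertwines the two torus actions (`fermiFlavourScale_onTorus`),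
  so the placed product is multiplied by the character `∏_f t_f^{(q_A + q_B) f}` (`map_mul`, `zpow_add₀`),
  which some torus element separates from `1` (`exists_torus_separating`); the exact vector flavour symmetry
  of the lattice QCD expectation (`qcdTorusExpect_eq_zero_of_fermiFlavourScale`) kills it;
* `⟨A⟩⟨B⟩ = 0`: one of `q_A`, `q_B` is non-zero, and the same selection rule kills that factor.

Hence the bound holds with the constant `C = 0`.  No scheme hypothesis is used.  Everything is proved (no
named fact); sources as in `QCDFlavourSymmetry.lean` (Montvay–Münster 1994 §5.1.1 (5.6); Osterwalder–Seiler
1978 §2).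
-/

noncomputable section

namespace Summit.QuantumFields.QCD.Cruxes.TorusHalfSpectrum.Birth.SelectionRule

open Filter
open Literature.MathematicalPhysics.QuantumFieldTheory
open Summit.QuantumFields.QCD.Theorems.StronglyChiralSubsequence (exists_torus_separating)

variable {Nf : ℕ}

/-! ### Characters of the flavour torus -/

/-- The product of the characters of charges `q_A` and `q_B` is the character of `q_A + q_B`
(on the torus `t_f ≠ 0`). -/
theorem prod_zpow_mul_prod_zpow {t : Fin Nf → ℂ} (ht : ∀ f, t f ≠ 0) (qA qB : Fin Nf → ℤ) :
    (∏ f, t f ^ qA f) * (∏ f, t f ^ qB f) = ∏ f, t f ^ (qA + qB) f := by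
  rw [← Finset.prod_mul_distrib]
  exact Finset.prod_congr rfl fun f _ => (zpow_add₀ (ht f) _ _).symm

/-- The character of the zero charge is trivial. -/
theorem prod_zpow_zero (t : Fin Nf → ℂ) : ∏ f, t f ^ (0 : Fin Nf → ℤ) f = 1 := by
  simp only [Pi.zero_apply, zpow_zero, Finset.prod_const_one]

/-- A non-zero charge vector carries a non-trivial character at some torus element. -/
theorem exists_torus_char_ne_one {q : Fin Nf → ℤ} (hq : q ≠ 0) :
    ∃ t : Fin Nf → ℂ, (∀ f, t f ≠ 0) ∧ ∏ f, t f ^ q f ≠ 1 := by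
  obtain ⟨t, ht, hne⟩ := exists_torus_separating hq
  exact ⟨t, ht, by rwa [prod_zpow_zero] at hne⟩

/-! ### Homogeneous observables placed on a torus -/

section Torus

variable {R R' S : ℕ} [NeZero S]

/-- **A homogeneous observable of charge `q`, placed on any torus, is a weight vector of the same character**
(the placement `onTorus` intertwines the boxed and the torus flavour actions). -/
theorem fermiFlavourScale_onTorus_of_homogeneous (A : QCDLatticeObservable Nf R) {q : Fin Nf → ℤ}
    (hA : ∀ t : Fin Nf → ℂ, (∀ f, t f ≠ 0) → ∀ U,
      QCDLatticeObservable.flavourScale t (A.F U) = (∏ f, t f ^ (q f)) • A.F U)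
    {t : Fin Nf → ℂ} (ht : ∀ f, t f ≠ 0) (v : Literature.Probability.LatticeModels.Site 4)
    (U : GaugeConfig 4 S (Matrix.specialUnitaryGroup (Fin 3) ℂ)) :
    fermiFlavourScale t (A.onTorus S v U) = (∏ f, t f ^ (q f)) • A.onTorus S v U := by
  rw [fermiFlavourScale_onTorus, hA t ht, map_smul, QCDLatticeObservable.onTorus]

/-- **Selection rule for one homogeneous observable**: `⟨A(v)⟩ = 0` on every torus, at every `β` and all
masses, if the charge of `A` is non-zero. -/
theorem qcdTorusExpect_onTorus_eq_zero (A : QCDLatticeObservable Nf R) {q : Fin Nf → ℤ} (hq : q ≠ 0)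
    (hA : ∀ t : Fin Nf → ℂ, (∀ f, t f ≠ 0) → ∀ U,
      QCDLatticeObservable.flavourScale t (A.F U) = (∏ f, t f ^ (q f)) • A.F U)
    (β : ℝ) (mq : Fin Nf → ℝ) (v : Literature.Probability.LatticeModels.Site 4) :
    qcdTorusExpect β S mq (A.onTorus S v) = 0 := by
  obtain ⟨t, ht, hne⟩ := exists_torus_char_ne_one hq
  exact qcdTorusExpect_eq_zero_of_fermiFlavourScale ht hne β mq _
    fun U => fermiFlavourScale_onTorus_of_homogeneous A hA ht v U

/-- **Selection rule for a product of two homogeneous observables**: `⟨A(v)·B(w)⟩ = 0` on every torus, at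
every `β` and all masses, if the charges do not add up to zero (the product is a weight vector of charge
`q_A + q_B`). -/
theorem qcdTorusExpect_mul_onTorus_eq_zero (A : QCDLatticeObservable Nf R) (B : QCDLatticeObservable Nf R')
    {qA qB : Fin Nf → ℤ}
    (hA : ∀ t : Fin Nf → ℂ, (∀ f, t f ≠ 0) → ∀ U,
      QCDLatticeObservable.flavourScale t (A.F U) = (∏ f, t f ^ (qA f)) • A.F U)
    (hB : ∀ t : Fin Nf → ℂ, (∀ f, t f ≠ 0) → ∀ U,
      QCDLatticeObservable.flavourScale t (B.F U) = (∏ f, t f ^ (qB f)) • B.F U)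
    (hq : qA + qB ≠ 0) (β : ℝ) (mq : Fin Nf → ℝ) (v w : Literature.Probability.LatticeModels.Site 4) :
    qcdTorusExpect β S mq (fun U => A.onTorus S v U * B.onTorus S w U) = 0 := by
  obtain ⟨t, ht, hne⟩ := exists_torus_char_ne_one hq
  refine qcdTorusExpect_eq_zero_of_fermiFlavourScale ht hne β mq _ fun U => ?_
  rw [map_mul, fermiFlavourScale_onTorus_of_homogeneous A hA ht v U,
    fermiFlavourScale_onTorus_of_homogeneous B hB ht w U, smul_mul_smul_comm,
    prod_zpow_mul_prod_zpow ht]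

/-- **The connected correlation of a non-opposite homogeneous pair vanishes identically**:
`⟨A(0)·B(n e₀)⟩ − ⟨A⟩⟨B⟩ = 0 − 0` for `q_A + q_B ≠ 0` (then `q_A ≠ 0` or `q_B ≠ 0`). -/
theorem qcdLatticeConnectedCorr_eq_zero (A : QCDLatticeObservable Nf R) (B : QCDLatticeObservable Nf R')
    {qA qB : Fin Nf → ℤ}
    (hA : ∀ t : Fin Nf → ℂ, (∀ f, t f ≠ 0) → ∀ U,
      QCDLatticeObservable.flavourScale t (A.F U) = (∏ f, t f ^ (qA f)) • A.F U)
    (hB : ∀ t : Fin Nf → ℂ, (∀ f, t f ≠ 0) → ∀ U,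
      QCDLatticeObservable.flavourScale t (B.F U) = (∏ f, t f ^ (qB f)) • B.F U)
    (hq : qA + qB ≠ 0) (β : ℝ) (mq : Fin Nf → ℝ) (n : ℕ) :
    qcdLatticeConnectedCorr β S mq A B n = 0 := by
  have hsingle : qcdTorusExpect β S mq (A.onTorus S 0) *
      qcdTorusExpect β S mq (B.onTorus S (Pi.single 0 (n : ℤ))) = 0 := by
    by_cases hqA : qA = 0
    · have hqB : qB ≠ 0 := fun h => hq (by rw [hqA, h, add_zero])
      rw [qcdTorusExpect_onTorus_eq_zero B hqB hB, mul_zero]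
    · rw [qcdTorusExpect_onTorus_eq_zero A hqA hA, zero_mul]
  rw [qcdLatticeConnectedCorr, qcdTorusExpect_mul_onTorus_eq_zero A B hA hB hq, hsingle, sub_zero]

end Torus

/-! ### The registered stub -/

/-- **Stub 3a of the birth skeleton of `TorusHalfSpectrum` — the exact flavour selection rule**
(= `SelectionRuleStmt` unfolded): a pair of flavour-homogeneous observables whose charge vectors are not
opposite (`q_A + q_B ≠ 0`) clusters at every rate `Δ` along every scheme, in the quantifier shape of
`QCDScheme.HasLatticeMassGap`, with the constant `C = 0` — its connected correlation vanishes identically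
on every torus, at every `β` and for all bare masses (`qcdLatticeConnectedCorr_eq_zero`). -/
theorem stub_selection_rule :
    ∀ (Nf : ℕ) (sch : QCDScheme Nf) (Δ : ℝ) (R R' : ℕ) (A : QCDLatticeObservable Nf R)
      (B : QCDLatticeObservable Nf R') (qA qB : Fin Nf → ℤ),
      (∀ t : Fin Nf → ℂ, (∀ f, t f ≠ 0) → ∀ U,
          QCDLatticeObservable.flavourScale t (A.F U) = (∏ f, t f ^ (qA f)) • A.F U) →
      (∀ t : Fin Nf → ℂ, (∀ f, t f ≠ 0) → ∀ U,
          QCDLatticeObservable.flavourScale t (B.F U) = (∏ f, t f ^ (qB f)) • B.F U) →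
      qA + qB ≠ 0 →
        ∃ C : ℝ, ∀ᶠ k in atTop, ∀ S : ℕ, sch.L k ≤ S → ∀ n : ℕ, n ≤ S →
          ‖qcdLatticeConnectedCorr (sch.β k) (2 * S + 1) (fun fl => sch.mq fl k) A B n‖ ≤
            C * Real.exp (-(Δ * (sch.a k * n))) := by
  intro Nf sch Δ R R' A B qA qB hA hB hq
  refine ⟨0, Eventually.of_forall fun k S _ n _ => ?_⟩
  rw [qcdLatticeConnectedCorr_eq_zero A B hA hB hq, norm_zero, zero_mul]

end Summit.QuantumFields.QCD.Cruxes.TorusHalfSpectrum.Birth.SelectionRule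

end
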